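import Summits.AnomalousDissipation.AnomalousDissipation.Theorems.SolenoidalFractalHomogenisationLagrangianStepSidebandOwnSlot
import HarnessLib

/-!
# K1L_D `stub_D1_exactFamily` clause (i) (`stub_D1_residue`, registry v16) — brick A1(c)-III(a): `feedbackⱼ ∘ responseⱼ` DURING SLOT `j` =
# `8π²|αⱼ|²·envⱼ(t) ∫ envⱼ(s) exp((t−s)Bⱼ) P_{mⱼ} ds` + wrap-around memory (helper; `--supports stmt-AnomalousDissipation-27980`)

Summits-side helper file of route `SolenoidalFractalHomogenisation` (prover seat `ad-sawtooth-k1loc-p1` g12; variant A of D26-6/D26-7; identification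
`diag psiStar = excQS`, `κ = 1`, behind `WCrossing.ΨB₁` p687442, numerically confirmed j322426).  Everything proved; no definitions, no named facts, no sorry.
* `restrictScalars_exp`, `exp_restrictScalars_smul` — the real block semigroup `exp(τ·B↾ℝ)` is the complex one read over `ℝ`, hence `ℂ`-homogeneous;
* `normSq_slotAmp` — `|αⱼ|² = 1/(16π²|mⱼ|²)`, so `8π²|αⱼ|² = 1/(2|mⱼ|²)` (`eight_pi_sq_mul_normSq_slotAmp`);
* **`feedback_response_eq_of_mem_slot`** — for ANY periodic response `N` of slot `j` (`±mⱼ` retained) and `t ∈ [startⱼ, startⱼ + τⱼ]`: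
  `feedbackⱼ(t)(N t v) = (8π²|αⱼ|² envⱼ(t)) • ∫_{startⱼ}^{t} envⱼ(s) • exp((t−s)·Bⱼ)(P_{mⱼ} v) ds`
  `+ 2πi envⱼ(t) • (αⱼ • exp((t−startⱼ)Bⱼ)(N startⱼ v)_{−mⱼ} + ᾱⱼ • exp((t−startⱼ)Bⱼ)(N startⱼ v)_{mⱼ})` — the own-slot quasi-static response
  kernel (the integrand of `qsResp` before the substitution to slot time) plus the wrap-around memory of the previous period, which
  `…SidebandOwnSlot.norm_exp_blockGen_le` and `…SidebandDecay.norm_response_le_exp_of_envelope_zero` make exponentially small.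
Remaining for the identification `M_{jj} = slotCoefⱼ·(4π²/ν)·slotQⱼ` (A1(c)-III(b)): the period mean, the substitution `t = startⱼ + (τⱼ¹)u`, and
`exp(u·Bⱼ) P = (NormedSpace.exp (−(Tⱼu) • regBlock S m̂ⱼ) * projPerp m̂ⱼ)` entrywise for `𝔸 = ν•S`, `W₁ = (cubatureWord.stretch MB).stretch (1/ν)`.
NOT a proof of any registered stub, of the crux, or of anomalous dissipation; rung leaf F-D1 infrastructure.
-/

set_option linter.dupNamespace false

noncomputable section

namespace Summit.AnomalousDissipation.AnomalousDissipation.Theorems.SolenoidalFractalHomogenisation.LagrangianStep.Sideband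

open Set MeasureTheory Complex NormedSpace intervalIntegral
open scoped InnerProductSpace
open Literature.Analysis Literature.Analysis.FunctionSpaces Literature.Analysis.FunctionSpaces.Torus
open Literature.Analysis.FluidPDE Literature.Analysis.FluidPDE.Torus Literature.Analysis.FluidPDE.LatticeShear

variable {k₀ : ℕ}

/-! ## §1 The real block semigroup is the complex one -/

/-- Restriction of scalars commutes with the exponential of endomorphisms of `ℂ³`. [folklore] -/
theorem restrictScalars_exp (B : EuclideanSpace ℂ (Fin 3) →L[ℂ] EuclideanSpace ℂ (Fin 3)) :
    (exp B).restrictScalars ℝ = exp (B.restrictScalars ℝ) := by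
  letI : Algebra ℚ (EuclideanSpace ℂ (Fin 3) →L[ℝ] EuclideanSpace ℂ (Fin 3)) :=
    RingHom.toAlgebra' ((algebraMap ℝ (EuclideanSpace ℂ (Fin 3) →L[ℝ] EuclideanSpace ℂ (Fin 3))).comp (algebraMap ℚ ℝ))
      (fun c x => Algebra.commutes _ _)
  let φ : (EuclideanSpace ℂ (Fin 3) →L[ℂ] EuclideanSpace ℂ (Fin 3)) →+* (EuclideanSpace ℂ (Fin 3) →L[ℝ] EuclideanSpace ℂ (Fin 3)) :=
    { toFun := fun f => f.restrictScalars ℝ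
      map_one' := rfl
      map_mul' := fun _ _ => rfl
      map_zero' := rfl
      map_add' := fun _ _ => rfl }
  have hφ : Continuous φ :=
    (ContinuousLinearMap.restrictScalarsIsometry ℂ (EuclideanSpace ℂ (Fin 3)) (EuclideanSpace ℂ (Fin 3)) ℝ ℝ).continuous
  exact map_exp_of_mem_ball (𝕂 := ℝ) φ hφ B (by simp [expSeries_radius_eq_top])

/-- `exp(τ·B↾ℝ) = exp((τ:ℂ)·B)↾ℝ`. [folklore] -/
theorem exp_smul_restrictScalars (B : EuclideanSpace ℂ (Fin 3) →L[ℂ] EuclideanSpace ℂ (Fin 3)) (τ : ℝ) :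
    exp (τ • B.restrictScalars ℝ) = (exp ((τ : ℂ) • B)).restrictScalars ℝ := by
  rw [restrictScalars_exp]
  rfl

/-- **The real block semigroup is `ℂ`-homogeneous**: `exp(τ·B↾ℝ)(c • w) = c • exp(τ·B↾ℝ) w`. [folklore] -/
theorem exp_restrictScalars_smul (B : EuclideanSpace ℂ (Fin 3) →L[ℂ] EuclideanSpace ℂ (Fin 3)) (τ : ℝ) (c : ℂ)
    (w : EuclideanSpace ℂ (Fin 3)) : exp (τ • B.restrictScalars ℝ) (c • w) = c • exp (τ • B.restrictScalars ℝ) w := by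
  rw [exp_smul_restrictScalars, ContinuousLinearMap.coe_restrictScalars', map_smul]

/-- The block semigroup `s ↦ exp((t − s)·B↾ℝ) w` is continuous. [folklore] -/
theorem continuous_exp_sub_smul_apply (B : EuclideanSpace ℂ (Fin 3) →L[ℝ] EuclideanSpace ℂ (Fin 3)) (t : ℝ) (w : EuclideanSpace ℂ (Fin 3)) :
    Continuous fun s : ℝ => exp ((t - s) • B) w :=
  have h1 : Continuous fun u : ℝ => exp (u • B) := continuous_iff_continuousAt.2 fun u => (hasDerivAt_exp_smul_const B u).continuousAt
  (h1.comp (continuous_const.sub continuous_id)).clm_apply continuous_const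

/-! ## §2 The slot amplitude -/

/-- `|αⱼ|² = 1/(16π²|mⱼ|²)`. [cite: MeshalkinSinai1961, pp. 1700–1705] -/
theorem normSq_slotAmp (W₁ : LatticeWord k₀) (j : Fin k₀) :
    Complex.normSq (slotAmp W₁ j) = 1 / (16 * Real.pi ^ 2 * ‖latticeVec (W₁.phase j).m‖ ^ 2) := by
  rw [slotAmp_def, Complex.normSq_mul, Complex.normSq_eq_norm_sq (Complex.exp _), Complex.norm_exp_ofReal_mul_I, one_pow, one_mul,
    Complex.normSq_eq_norm_sq]
  rw [norm_div, norm_one, norm_mul, Complex.norm_I, mul_one]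
  have h2 : ‖(2 : ℂ) * ((2 * Real.pi * ‖latticeVec (W₁.phase j).m‖ : ℝ) : ℂ)‖ = 2 * (2 * Real.pi * ‖latticeVec (W₁.phase j).m‖) := by
    rw [norm_mul, Complex.norm_real, Complex.norm_two, Real.norm_of_nonneg (by positivity)]
  rw [h2]
  have hπ := Real.pi_pos
  by_cases h0 : ‖latticeVec (W₁.phase j).m‖ = 0
  · rw [h0]; simp
  · field_simp
    ring

/-- `8π²|αⱼ|² = 1/(2|mⱼ|²)`. [cite: MeshalkinSinai1961, pp. 1700–1705] -/
theorem eight_pi_sq_mul_normSq_slotAmp (W₁ : LatticeWord k₀) (j : Fin k₀) :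
    8 * Real.pi ^ 2 * Complex.normSq (slotAmp W₁ j) = 1 / (2 * ‖latticeVec (W₁.phase j).m‖ ^ 2) := by
  rw [normSq_slotAmp]
  have hπ := Real.pi_pos
  by_cases h0 : ‖latticeVec (W₁.phase j).m‖ = 0
  · rw [h0]; simp
  · field_simp
    ring

/-- `αⱼ·c̄ + ᾱⱼ·c` at `c = −2πi e αⱼ`: `αⱼ(−2πi e ᾱⱼ) + ᾱⱼ(−2πi e αⱼ) = −4πi e |αⱼ|²`. [folklore] -/
theorem slotAmp_cross (W₁ : LatticeWord k₀) (j : Fin k₀) (e : ℂ) :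
    slotAmp W₁ j * (-(2 * Real.pi * Complex.I * e * starRingEnd ℂ (slotAmp W₁ j))) +
      starRingEnd ℂ (slotAmp W₁ j) * (-(2 * Real.pi * Complex.I * e * slotAmp W₁ j)) =
      -(4 * Real.pi * Complex.I * e * (Complex.normSq (slotAmp W₁ j) : ℂ)) := by
  rw [← Complex.mul_conj]
  ring

/-! ## §3 The feedback during the slot: quasi-static kernel + wrap-around -/

set_option maxHeartbeats 400000 in
/-- **`feedbackⱼ ∘ Nⱼ` DURING SLOT `j`.**  For any periodic response `N` of slot `j` (`±mⱼ` retained) and `t ∈ [startⱼ, startⱼ + τⱼ]`: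
`feedbackⱼ(t)(N t v) = (8π²|αⱼ|² envⱼ(t)) • ∫_{startⱼ}^{t} envⱼ(s) • exp((t−s)·Bⱼ)(P_{mⱼ} v) ds + 2πi envⱼ(t) • (αⱼ • exp((t−startⱼ)Bⱼ) u₋⁰ + ᾱⱼ • exp((t−startⱼ)Bⱼ) u₊⁰)`
with `u±⁰ = (N startⱼ v)_{±mⱼ}`, `Bⱼ = blockGen 𝔸 γ₁ mⱼ` over `ℝ` (`8π²|αⱼ|² = 1/(2|mⱼ|²)` by `eight_pi_sq_mul_normSq_slotAmp`).
[cite: MajdaKramer1999, §2.2.1.3 (55) (effective diffusivity as a cell average)] [cite: Hale1980, Ch. III §1, Theorem 1.1] -/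
theorem feedback_response_eq_of_mem_slot (W₁ : LatticeWord k₀) (𝔸 : Torus.Visc4 (Fin 3)) (γ₁ : ℝ) (R : ℕ) (j : Fin k₀)
    {N : ℝ → (EuclideanSpace ℂ (Fin 3) →L[ℝ] Space R)} (hN : IsPeriodicResponse W₁ 𝔸 γ₁ R j N)
    (hm : (W₁.phase j).m ∈ box R) (hm' : -(W₁.phase j).m ∈ box R) (v : EuclideanSpace ℂ (Fin 3)) {t : ℝ}
    (ht : t ∈ Icc (W₁.start j) (W₁.start j + (W₁.phase j).τ)) :
    feedback W₁ R j t (N t v) =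
      (((8 * Real.pi ^ 2 * Complex.normSq (slotAmp W₁ j) * slotEnvelope W₁ j t : ℝ) : ℂ)) •
        (∫ s in W₁.start j..t, ((slotEnvelope W₁ j s : ℝ) : ℂ) •
          exp ((t - s) • (blockGen 𝔸 γ₁ (W₁.phase j).m).restrictScalars ℝ) (transversalProj (W₁.phase j).m v)) +
      (2 * Real.pi * Complex.I * ((slotEnvelope W₁ j t : ℝ) : ℂ)) •
        (slotAmp W₁ j • exp ((t - W₁.start j) • (blockGen 𝔸 γ₁ (W₁.phase j).m).restrictScalars ℝ) (coordL R (-(W₁.phase j).m) (N (W₁.start j) v)) +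
          starRingEnd ℂ (slotAmp W₁ j) •
            exp ((t - W₁.start j) • (blockGen 𝔸 γ₁ (W₁.phase j).m).restrictScalars ℝ) (coordL R (W₁.phase j).m (N (W₁.start j) v))) := by
  set m := (W₁.phase j).m with hmdef
  set Bℝ := (blockGen 𝔸 γ₁ m).restrictScalars ℝ with hB
  set α := slotAmp W₁ j with hα
  set env : ℝ → ℝ := slotEnvelope W₁ j with henv
  set P := transversalProj m with hP
  set t₀ := W₁.start j with ht₀
  -- the two own-fibre Duhamel formulas, with `B(−m) = B(m)` and `P_{−m} = P_m`
  have hDp := coordL_response_eq_duhamel_self W₁ 𝔸 γ₁ R j hN hm v ht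
  have hDn := coordL_response_eq_duhamel_neg W₁ 𝔸 γ₁ R j hN hm' v ht
  rw [blockGen_neg] at hDn
  simp only [transversalProj_neg_wave] at hDn
  rw [feedback_apply, hDp, hDn]
  simp only [← hmdef, ← hB, ← hα, ← henv, ← hP, ← ht₀]
  -- name the three integrands (opaque local functions, to keep unification syntactic)
  have hEc : Continuous fun s : ℝ => exp ((t - s) • Bℝ) (P v) := continuous_exp_sub_smul_apply Bℝ t (P v)
  have henvc : Continuous fun s : ℝ => ((env s : ℝ) : ℂ) := Complex.continuous_ofReal.comp (continuous_slotEnvelope W₁ j)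
  obtain ⟨f₁, hf₁⟩ : ∃ f : ℝ → EuclideanSpace ℂ (Fin 3), f = fun s =>
      (-(2 * Real.pi * Complex.I * ((env s : ℝ) : ℂ) * starRingEnd ℂ α)) • exp ((t - s) • Bℝ) (P v) := ⟨_, rfl⟩
  obtain ⟨f₂, hf₂⟩ : ∃ f : ℝ → EuclideanSpace ℂ (Fin 3), f = fun s =>
      (-(2 * Real.pi * Complex.I * ((env s : ℝ) : ℂ) * α)) • exp ((t - s) • Bℝ) (P v) := ⟨_, rfl⟩
  obtain ⟨g, hg⟩ : ∃ f : ℝ → EuclideanSpace ℂ (Fin 3), f = fun s => ((env s : ℝ) : ℂ) • exp ((t - s) • Bℝ) (P v) := ⟨_, rfl⟩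
  have hc₁ : Continuous f₁ := by rw [hf₁]; exact ((continuous_const.mul henvc).mul continuous_const).neg.smul hEc
  have hc₂ : Continuous f₂ := by rw [hf₂]; exact ((continuous_const.mul henvc).mul continuous_const).neg.smul hEc
  -- pull the complex scalars through the real semigroup
  have hIp : ∫ s in t₀..t, exp ((t - s) • Bℝ) ((-(2 * Real.pi * Complex.I * ((env s : ℝ) : ℂ) * α)) • P v) = ∫ s in t₀..t, f₂ s :=
    integral_congr fun s _ => by rw [hf₂]; simp only [hB, exp_restrictScalars_smul]
  have hIn : ∫ s in t₀..t, exp ((t - s) • Bℝ) ((-(2 * Real.pi * Complex.I * ((env s : ℝ) : ℂ) * starRingEnd ℂ α)) • P v) =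
      ∫ s in t₀..t, f₁ s :=
    integral_congr fun s _ => by rw [hf₁]; simp only [hB, exp_restrictScalars_smul]
  have hG : ∫ s in t₀..t, ((env s : ℝ) : ℂ) • exp ((t - s) • Bℝ) (P v) = ∫ s in t₀..t, g s :=
    integral_congr fun s _ => by rw [hg]
  rw [hIp, hIn, hG]
  -- pointwise: `2πi env(t) · (α c₋(s) + ᾱ c₊(s)) = 8π² |α|² env(t) env(s)`
  have hpt : ∀ s, (2 * Real.pi * Complex.I * ((env t : ℝ) : ℂ)) • (α • f₁ s + starRingEnd ℂ α • f₂ s) =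
      (((8 * Real.pi ^ 2 * Complex.normSq α * env t : ℝ) : ℂ)) • g s := by
    intro s
    rw [hf₁, hf₂, hg]
    simp only [smul_smul, ← add_smul]
    congr 1
    rw [hα, slotAmp_cross W₁ j]
    push_cast
    linear_combination (-(8:ℂ) * Real.pi ^ 2 * (env t : ℂ) * (env s : ℂ) * (Complex.normSq (slotAmp W₁ j) : ℂ)) * Complex.I_mul_I
  -- integrals
  have hi₁ : IntervalIntegrable (fun s => α • f₁ s) volume t₀ t := (hc₁.const_smul α).intervalIntegrable _ _
  have hi₂ : IntervalIntegrable (fun s => starRingEnd ℂ α • f₂ s) volume t₀ t := (hc₂.const_smul (starRingEnd ℂ α)).intervalIntegrable _ _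
  have e1 : ∫ s in t₀..t, (α • f₁ s + starRingEnd ℂ α • f₂ s) = (α • ∫ s in t₀..t, f₁ s) + starRingEnd ℂ α • ∫ s in t₀..t, f₂ s := by
    rw [intervalIntegral.integral_add hi₁ hi₂, intervalIntegral.integral_smul, intervalIntegral.integral_smul]
  have e2 : ∫ s in t₀..t, (2 * Real.pi * Complex.I * ((env t : ℝ) : ℂ)) • (α • f₁ s + starRingEnd ℂ α • f₂ s) =
      (2 * Real.pi * Complex.I * ((env t : ℝ) : ℂ)) • ∫ s in t₀..t, (α • f₁ s + starRingEnd ℂ α • f₂ s) := by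
    rw [intervalIntegral.integral_smul]
  have e3 : ∫ s in t₀..t, (2 * Real.pi * Complex.I * ((env t : ℝ) : ℂ)) • (α • f₁ s + starRingEnd ℂ α • f₂ s) =
      ∫ s in t₀..t, (((8 * Real.pi ^ 2 * Complex.normSq α * env t : ℝ) : ℂ)) • g s :=
    integral_congr fun s _ => hpt s
  have e4 : ∫ s in t₀..t, (((8 * Real.pi ^ 2 * Complex.normSq α * env t : ℝ) : ℂ)) • g s =
      (((8 * Real.pi ^ 2 * Complex.normSq α * env t : ℝ) : ℂ)) • ∫ s in t₀..t, g s := by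
    rw [intervalIntegral.integral_smul]
  have key : (2 * Real.pi * Complex.I * ((env t : ℝ) : ℂ)) • ((α • ∫ s in t₀..t, f₁ s) + starRingEnd ℂ α • ∫ s in t₀..t, f₂ s) =
      (((8 * Real.pi ^ 2 * Complex.normSq α * env t : ℝ) : ℂ)) • ∫ s in t₀..t, g s := by
    rw [← e1, ← e2, e3, e4]
  -- final assembly (pure additive bookkeeping, no restatement of the large terms)
  rw [← key, ← smul_add]
  refine congrArg (fun y => (2 * Real.pi * Complex.I * ((env t : ℝ) : ℂ)) • y) ?_
  rw [smul_add, smul_add]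
  exact (add_add_add_comm _ _ _ _).trans (add_comm _ _)

end Summit.AnomalousDissipation.AnomalousDissipation.Theorems.SolenoidalFractalHomogenisation.LagrangianStep.Sideband
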